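import Summits.KontsevichZagierPeriods.KontsevichZagierPeriods.Theorems.HurwitzMicroSectorsNormalFormPrincipleM2FiveZetaTwo
import Summits.KontsevichZagierPeriods.KontsevichZagierPeriods.Theorems.HurwitzMicroSectorsNormalFormPrincipleM2LogMonomialInvSubZetaBandRat
import Summits.KontsevichZagierPeriods.KontsevichZagierPeriods.Theorems.HurwitzMicroSectorsNormalFormPrincipleLevelOne

/-!
# `NormalFormPrinciple` (stmt-KontsevichZagierPeriods-3869), line `SketchIdeator1` — leaf `stub_boxRigidity`:
# the cyclotomic log layer: the two cyclotomic base cases (`cyclo_base`)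

Registered sub-goal `cyclo_base` of the cyclotomic log layer (lead file `…CycloLog`). Write
`σ = (0,1) ⊆ ℝ¹`, `M(g, v) = [{x ∈ σ, 1 ≤ s ≤ v x}, g(x)/s]` (an unfolded log monomial, value
`∫₀¹ g log v`), `H_{d+1}(x) = 1/(1 − x^(d+1))`, `G_{d+1}(x) = Σ_{i ≤ d} xⁱ`, so that
`G_{d+1} · H_{d+1} = 1/(1 − x)` on `σ`. For `c ∈ ℚ` and `d ∈ ℕ`:
* `M(c/x, H_{d+1}) ≡ [(0,1)², (c/(d+1))/(1 − xy)]`: the dilation `u = x^(d+1)` (rule 2,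
  `logMonomial_dilate`) gives `M(c/((d+1)u), 1/(1 − u))`; the ζ(2) block with the rational weight
  `c/(d+1)` (fibre substitution `s = 1 + θ(v − 1)` and reflection `θ ↦ 1 − θ`, rule 2;
  `logMonomialInv_sub_zetaBand_rat`) gives the band-box `[{0 < x < 1, 0 ≤ y ≤ 1}, (c/(d+1))/(1 − xy)]`,
  which is the open box up to two null edges (rule 1a, `of_box_sub_nsmul_of_band_mem_relations`);
* `M(c/x, G_{d+1}) ≡ [(0,1)², (c − c/(d+1))/(1 − xy)]`: the unfolded product rule
  `M(c/x, 1/(1 − x)) ≡ M(c/x, G_{d+1}) + M(c/x, H_{d+1})` (`KZ.of_sub_of_sub_mem_relations_mul`,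
  rules 1a + 2), the ζ(2) block for `M(c/x, 1/(1 − x))`, the first case, and the additivity of the
  level-one boxes `[(0,1)², β/(1 − xy)]` in `β` (`LevelOne.zetaTwoRep_add_mem_relations`, rule 1b).
References: M. Kontsevich, D. Zagier, *Periods* (2001), §1.2 (rules (1), (2)). No new definitions.
-/

noncomputable section

open MeasureTheory Set
open Literature.NumberTheory.Transcendental Literature.NumberTheory.Transcendental.KZ
open Literature.ModelTheory.ExponentialFields (IsSemialgebraic)

namespace Summit.KontsevichZagierPeriods.HurwitzMicroSectors.NormalFormPrinciple.PiBox.M2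

/-! ## Rational multiples of the weights and of Beukers' kernel -/

/-- The weight `c/((n)x)` (`c ∈ ℚ`, `n ≠ 0`) is `ℚ`-semialgebraic on `(0,1)`. [folklore] -/
private theorem isSemialgebraicFunOn_ratCast_div_natMul (c : ℚ) {n : ℕ} (hn : n ≠ 0) :
    IsSemialgebraicFunOn ℚ {y : Fin 1 → ℝ | 0 < y 0 ∧ y 0 < 1}
      (fun y => (fun x : ℝ => (c : ℝ) / ((n : ℝ) * x)) (y 0)) := by
  refine (isSemialgebraicFunOn_aeval_div_aeval isSemialgebraic_unitInterval_fin_one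
    (MvPolynomial.C c) (MvPolynomial.C (n : ℚ) * MvPolynomial.X 0) fun y hy => ?_).congr
    fun y _ => by simp
  have h1 : (n : ℝ) ≠ 0 := Nat.cast_ne_zero.2 hn
  simpa [h1] using hy.1.ne'

/-- The weight `c/x` (`c ∈ ℚ`) is `ℚ`-semialgebraic on `(0,1)`. [folklore] -/
private theorem isSemialgebraicFunOn_ratCast_div (c : ℚ) :
    IsSemialgebraicFunOn ℚ {y : Fin 1 → ℝ | 0 < y 0 ∧ y 0 < 1}
      (fun y => (fun x : ℝ => (c : ℝ) / x) (y 0)) := by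
  refine (isSemialgebraicFunOn_aeval_div_aeval isSemialgebraic_unitInterval_fin_one
    (MvPolynomial.C c) (MvPolynomial.X 0) fun y hy => ?_).congr fun y _ => by simp
  simpa using hy.1.ne'

/-- The band-box representation `[{0 < x < 1, 0 ≤ y ≤ 1}, q/(1 − xy)]` exists for every `q ∈ ℚ`:
a rational multiple of Beukers' kernel, integrable on the band-box (`exists_bandBoxRep_zeta`).
[folklore] -/
private theorem exists_bandBoxRep_zeta_ratCast (q : ℚ) :
    ∃ Z : IntegralRep 2,
      Z.domain = KZlog.band {y : Fin 1 → ℝ | 0 < y 0 ∧ y 0 < 1} (fun _ => (0:ℝ)) (fun _ => (1:ℝ)) ∧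
      Z.integrand = fun z => (q : ℝ) / (1 - z 0 * z 1) := by
  obtain ⟨Z₁, hZ₁d, hZ₁i⟩ := exists_bandBoxRep_zeta
  have hB := isSemialgebraic_bandBox
  have hsa : IsSemialgebraicFunOn ℚ
      (KZlog.band {y : Fin 1 → ℝ | 0 < y 0 ∧ y 0 < 1} (fun _ => (0:ℝ)) (fun _ => (1:ℝ)))
      (fun z => (q : ℝ) / (1 - z 0 * z 1)) := by
    refine (isSemialgebraicFunOn_aeval_div_aeval hB (MvPolynomial.C q)
      (1 - MvPolynomial.X 0 * MvPolynomial.X 1) fun x hx => ?_).congr fun x _ => by simp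
    have h : (0 < x 0 ∧ x 0 < 1) ∧ 0 ≤ x 1 ∧ x 1 ≤ 1 := hx
    simp only [map_sub, map_mul, map_one, MvPolynomial.aeval_X]
    have h01 : x 0 * x 1 ≤ x 0 * 1 := mul_le_mul_of_nonneg_left h.2.2 h.1.1.le
    exact (show (0:ℝ) < 1 - x 0 * x 1 by linarith [h.1.2]).ne'
  have hint : IntegrableOn (fun z : Fin 2 → ℝ => (q : ℝ) / (1 - z 0 * z 1))
      (KZlog.band {y : Fin 1 → ℝ | 0 < y 0 ∧ y 0 < 1} (fun _ => (0:ℝ)) (fun _ => (1:ℝ))) := by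
    have h := Z₁.integrableOn
    rw [hZ₁d, hZ₁i] at h
    have h' : IntegrableOn (fun z : Fin 2 → ℝ => (q : ℝ) * (1 / (1 - z 0 * z 1)))
        (KZlog.band {y : Fin 1 → ℝ | 0 < y 0 ∧ y 0 < 1} (fun _ => (0:ℝ)) (fun _ => (1:ℝ))) :=
      h.const_mul (q : ℝ)
    refine h'.congr_fun (fun z _ => ?_)
      (Literature.ModelTheory.ExponentialFields.IsSemialgebraic.measurableSet_holds hB)
    simp only [mul_one_div]
  exact ⟨⟨_, _, hB, hsa, hint⟩, rfl, rfl⟩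

/-! ## The two base cases -/

/-- **First base case: `M(c/x, H_{d+1}) ≡ [(0,1)², (c/(d+1))/(1 − xy)]`.** The dilation
`u = x^(d+1)` (`logMonomial_dilate`, rule 2), the ζ(2) block with the weight `c/(d+1)` (rule 2), and
the two null edges between the open box and the band-box (rule 1a).
[cite: KontsevichZagier2001, §1.2] -/
private theorem cyclo_base_inv (c : ℚ) (d : ℕ) (Hd B : IntegralRep 2)
    (hHdd : Hd.domain = KZlog.band {y : Fin 1 → ℝ | 0 < y 0 ∧ y 0 < 1} (fun _ => (1:ℝ))
      (fun y => 1 / (1 - y 0 ^ (d + 1))))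
    (hHdi : EqOn Hd.integrand (fun z => ((c : ℝ) / z 0) / z 1) Hd.domain)
    (hBd : B.domain = {x | ∀ i, x i ∈ Set.Ioo (0:ℝ) 1})
    (hBi : EqOn B.integrand (fun x => ((c / (d + 1) : ℚ) : ℝ) / (1 - x 0 * x 1)) B.domain) :
    of Hd - of B ∈ relations := by
  -- the dilated monomial `L' = M(c/((d+1)u), 1/(1 − u))` and the band-box `Zq` of weight `c/(d+1)`
  have h1L : ∀ x ∈ Set.Ioo (0:ℝ) 1, 1 ≤ (fun x : ℝ => 1 / (1 - x)) x := fun x hx =>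
    one_le_one_div (sub_pos.2 hx.2) (by linarith [hx.1])
  have hIL' : IntegrableOn (fun x : ℝ => (fun x : ℝ => (c : ℝ) / (((d + 1 : ℕ) : ℝ) * x)) x *
      Real.log ((fun x : ℝ => 1 / (1 - x)) x)) (Set.Ioo (0:ℝ) 1) := by
    refine (integrable_logs.2.2.2.2 ((c : ℝ) / ((d + 1 : ℕ) : ℝ)) 1 le_rfl).congr_fun
      (fun x _ => ?_) measurableSet_Ioo
    simp only [pow_one, div_div]
  obtain ⟨L', hL'd, hL'i⟩ := exists_logMonomialRep (fun x : ℝ => (c : ℝ) / (((d + 1 : ℕ) : ℝ) * x))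
    (fun x : ℝ => 1 / (1 - x)) (isSemialgebraicFunOn_ratCast_div_natMul c (Nat.succ_ne_zero d))
    isSemialgebraicFunOn_one_div_one_sub h1L hIL'
  obtain ⟨Zq, hZqd, hZqi⟩ := exists_bandBoxRep_zeta_ratCast (c / (d + 1))
  -- (rule 2) the dilation `u = x^(d+1)`
  have e1 : of Hd - of L' ∈ relations :=
    logMonomial_dilate d (c : ℝ) (fun u => 1 / (1 - u)) Hd L' hHdd hHdi hL'd (hL'i ▸ fun _ _ => rfl)
  -- (rule 2) the ζ(2) block with the weight `c/(d+1)`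
  have e2 : of L' - of Zq ∈ relations := by
    refine logMonomialInv_sub_zetaBand_rat (c / (d + 1)) L' Zq hL'd (fun z _ => ?_) hZqd
      (hZqi ▸ fun _ _ => rfl)
    rw [hL'i]
    push_cast
    simp only [div_div]
  -- (rule 1a) the open box versus the band-box
  have e3 : of B - 1 • of Zq ∈ relations := by
    refine of_box_sub_nsmul_of_band_mem_relations 1
      (fun x => ((c / (d + 1) : ℚ) : ℝ) / (1 - x 0 * x 1)) B Zq hBd (fun x hx => ?_) hZqd
      (hZqi ▸ fun _ _ => rfl)
    rw [hBi hx]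
    simp
  have e : of Hd - of B = (of Hd - of L') + (of L' - of Zq) - (of B - 1 • of Zq) := by
    rw [one_nsmul]
    abel
  rw [e]
  exact relations.sub_mem (relations.add_mem e1 e2) e3

/-- **Second base case: `M(c/x, G_{d+1}) ≡ [(0,1)², (c − c/(d+1))/(1 − xy)]`.** The unfolded
product rule for `G_{d+1} · H_{d+1} = 1/(1 − x)` (`KZ.of_sub_of_sub_mem_relations_mul`, rules 1a + 2),
the ζ(2) block for `M(c/x, 1/(1 − x))`, the first base case for `M(c/x, H_{d+1})`, and the
additivity of the level-one boxes in the coefficient (`LevelOne.zetaTwoRep_add_mem_relations`,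
rule 1b). [cite: KontsevichZagier2001, §1.2] -/
private theorem cyclo_base_geom (c : ℚ) (d : ℕ) (Gd B : IntegralRep 2)
    (hGdd : Gd.domain = KZlog.band {y : Fin 1 → ℝ | 0 < y 0 ∧ y 0 < 1} (fun _ => (1:ℝ))
      (fun y => ∑ i ∈ Finset.range (d + 1), y 0 ^ i))
    (hGdi : EqOn Gd.integrand (fun z => ((c : ℝ) / z 0) / z 1) Gd.domain)
    (hBd : B.domain = {x | ∀ i, x i ∈ Set.Ioo (0:ℝ) 1})
    (hBi : EqOn B.integrand (fun x => ((c - c / (d + 1) : ℚ) : ℝ) / (1 - x 0 * x 1)) B.domain) :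
    of Gd - of B ∈ relations := by
  have hG : IsSemialgebraic ℚ {y : Fin 1 → ℝ | 0 < y 0 ∧ y 0 < 1} :=
    isSemialgebraic_unitInterval_fin_one
  have hd1 : d + 1 ≠ 0 := Nat.succ_ne_zero d
  -- the edges `G = Σ_{i ≤ d} xⁱ ≥ 1`, `H = 1/(1 − x^(d+1)) ≥ 1` on `(0,1)`, and `G · H = 1/(1 − x)`
  have hu : IsSemialgebraicFunOn ℚ {y : Fin 1 → ℝ | 0 < y 0 ∧ y 0 < 1}
      (fun y => ∑ i ∈ Finset.range (d + 1), y 0 ^ i) :=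
    (isSemialgebraicFunOn_aeval hG (∑ i ∈ Finset.range (d + 1), MvPolynomial.X 0 ^ i)).congr
      fun y _ => by simp
  have hu1 : ∀ y ∈ {y : Fin 1 → ℝ | 0 < y 0 ∧ y 0 < 1},
      (1:ℝ) ≤ ∑ i ∈ Finset.range (d + 1), y 0 ^ i := fun y hy => by
    rw [Finset.sum_range_succ', pow_zero]
    exact le_add_of_nonneg_left (Finset.sum_nonneg fun i _ => pow_nonneg hy.1.le _)
  have hw1 : ∀ x ∈ Set.Ioo (0:ℝ) 1, 1 ≤ (fun x : ℝ => 1 / (1 - x ^ (d + 1))) x := fun x hx => by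
    have hxk : x ^ (d + 1) < 1 := pow_lt_one₀ hx.1.le hx.2 hd1
    have hxk0 : 0 ≤ x ^ (d + 1) := pow_nonneg hx.1.le _
    exact one_le_one_div (sub_pos.2 hxk) (by linarith)
  have h1L : ∀ x ∈ Set.Ioo (0:ℝ) 1, 1 ≤ (fun x : ℝ => 1 / (1 - x)) x := fun x hx =>
    one_le_one_div (sub_pos.2 hx.2) (by linarith [hx.1])
  have hGH : ∀ y ∈ {y : Fin 1 → ℝ | 0 < y 0 ∧ y 0 < 1}, 1 / (1 - y 0) =
      (∑ i ∈ Finset.range (d + 1), y 0 ^ i) * (1 / (1 - y 0 ^ (d + 1))) := fun y hy => by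
    have h1 : (1:ℝ) - y 0 ≠ 0 := (sub_pos.2 hy.2).ne'
    have hk : (1:ℝ) - y 0 ^ (d + 1) ≠ 0 := (sub_pos.2 (pow_lt_one₀ hy.1.le hy.2 hd1)).ne'
    rw [mul_one_div, div_eq_div_iff h1 hk, one_mul, geom_sum_mul_neg]
  -- the monomials `L = M(c/x, 1/(1 − x))` and `Hd = M(c/x, H_{d+1})`
  have hg := isSemialgebraicFunOn_ratCast_div c
  have hIL : IntegrableOn (fun x : ℝ => (fun x : ℝ => (c : ℝ) / x) x *
      Real.log ((fun x : ℝ => 1 / (1 - x)) x)) (Set.Ioo (0:ℝ) 1) := by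
    refine (integrable_logs.2.2.2.2 (c : ℝ) 1 le_rfl).congr_fun (fun x _ => ?_) measurableSet_Ioo
    simp only [pow_one]
  have hIH : IntegrableOn (fun x : ℝ => (fun x : ℝ => (c : ℝ) / x) x *
      Real.log ((fun x : ℝ => 1 / (1 - x ^ (d + 1))) x)) (Set.Ioo (0:ℝ) 1) :=
    integrable_logs.2.2.2.2 (c : ℝ) (d + 1) (by omega)
  obtain ⟨L, hLd, hLi⟩ := exists_logMonomialRep (fun x : ℝ => (c : ℝ) / x) (fun x : ℝ => 1 / (1 - x))
    hg isSemialgebraicFunOn_one_div_one_sub h1L hIL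
  obtain ⟨Hd, hHdd, hHdi⟩ := exists_logMonomialRep (fun x : ℝ => (c : ℝ) / x)
    (fun x : ℝ => 1 / (1 - x ^ (d + 1))) hg (isSemialgebraicFunOn_one_div_one_sub_pow hd1) hw1 hIH
  -- the level-one boxes of coefficients `c`, `c/(d+1)` and the band-box of coefficient `c`
  obtain ⟨Bc, hBcd, hBci⟩ := LevelOne.exists_zetaTwoRep c
  obtain ⟨Bq, hBqd, hBqi⟩ := LevelOne.exists_zetaTwoRep (c / (d + 1))
  obtain ⟨Zc, hZcd, hZci⟩ := exists_bandBoxRep_zeta_ratCast c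
  -- (rules 1a + 2) the product rule `log (G · H) = log G + log H`
  have e1 : of L - of Gd - of Hd ∈ relations :=
    KZ.of_sub_of_sub_mem_relations_mul (g := fun y => (c : ℝ) / y 0)
      (u := fun y => ∑ i ∈ Finset.range (d + 1), y 0 ^ i) (w := fun y => 1 / (1 - y 0 ^ (d + 1)))
      hG hu (isSemialgebraicFunOn_one_div_one_sub_pow hd1) hu1 (fun y hy => hw1 (y 0) hy) L Gd Hd
      (hLd.trans (KZlog.band_congr hGH)) (hLi ▸ fun _ _ => rfl) hGdd hGdi hHdd
      (hHdi ▸ fun _ _ => rfl)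
  -- (rule 2) the ζ(2) block with the weight `c`; (rule 1a) the open box versus the band-box
  have e2 : of L - of Zc ∈ relations :=
    logMonomialInv_sub_zetaBand_rat c L Zc hLd (hLi ▸ fun _ _ => rfl) hZcd (hZci ▸ fun _ _ => rfl)
  have e3 : of Bc - 1 • of Zc ∈ relations := by
    refine of_box_sub_nsmul_of_band_mem_relations 1 (fun x => (c : ℝ) / (1 - x 0 * x 1)) Bc Zc hBcd
      (fun x hx => ?_) hZcd (hZci ▸ fun _ _ => rfl)
    rw [hBci hx]
    simp
  -- the first base case for `Hd`
  have e4 : of Hd - of Bq ∈ relations :=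
    cyclo_base_inv c d Hd Bq hHdd (hHdi ▸ fun _ _ => rfl) hBqd hBqi
  -- (rule 1b) additivity of the level-one boxes: `c = (c − c/(d+1)) + c/(d+1)`
  have e5 : of Bc - of B - of Bq ∈ relations := by
    refine LevelOne.zetaTwoRep_add_mem_relations (β₁ := c - c / (d + 1)) (β₂ := c / (d + 1)) Bc B Bq
      hBcd (fun x hx => ?_) hBd hBi hBqd hBqi
    rw [hBci hx, sub_add_cancel]
  have e : of Gd - of B = (of L - of Zc) - (of Bc - 1 • of Zc) - (of L - of Gd - of Hd)
      - (of Hd - of Bq) + (of Bc - of B - of Bq) := by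
    rw [one_nsmul]
    abel
  rw [e]
  exact relations.add_mem (relations.sub_mem (relations.sub_mem (relations.sub_mem e2 e3) e1) e4) e5

/-- **Stub (the two cyclotomic base cases of the cyclotomic log layer).** For `c ∈ ℚ`, `d ∈ ℕ`,
with `M(g, v) = [{0 < x < 1, 1 ≤ s ≤ v x}, g(x)/s]` (any representation with this band as domain
and this integrand on it) and `[(0,1)², β/(1 − xy)]` the level-one box (any representation on the
open box with this integrand on it):
`M(c/x, 1/(1 − x^(d+1))) ≡ [(0,1)², (c/(d+1))/(1 − xy)]` (dilation `u = x^(d+1)` and the ζ(2) block,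
rule 2, plus two null edges, rule 1a) and `M(c/x, Σ_{i ≤ d} xⁱ) ≡ [(0,1)², (c − c/(d+1))/(1 − xy)]`
(the unfolded product rule for `(Σ_{i ≤ d} xⁱ) · 1/(1 − x^(d+1)) = 1/(1 − x)`, the first case, and
additivity in `β`, rules 1a, 1b, 2). Both sides of each congruence have the value
`c ζ(2)/(d+1)`, resp. `c ζ(2) (1 − 1/(d+1))`. [cite: KontsevichZagier2001, §1.2] -/
theorem cyclo_base (c : ℚ) (d : ℕ) :
    (∀ (Hd B : IntegralRep 2),
      Hd.domain = KZlog.band {y : Fin 1 → ℝ | 0 < y 0 ∧ y 0 < 1} (fun _ => (1:ℝ))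
        (fun y => 1 / (1 - y 0 ^ (d + 1))) →
      EqOn Hd.integrand (fun z => ((c : ℝ) / z 0) / z 1) Hd.domain →
      B.domain = {x | ∀ i, x i ∈ Set.Ioo (0:ℝ) 1} →
      EqOn B.integrand (fun x => ((c / (d + 1) : ℚ) : ℝ) / (1 - x 0 * x 1)) B.domain →
      of Hd - of B ∈ relations) ∧
    (∀ (Gd B : IntegralRep 2),
      Gd.domain = KZlog.band {y : Fin 1 → ℝ | 0 < y 0 ∧ y 0 < 1} (fun _ => (1:ℝ))
        (fun y => ∑ i ∈ Finset.range (d + 1), y 0 ^ i) →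
      EqOn Gd.integrand (fun z => ((c : ℝ) / z 0) / z 1) Gd.domain →
      B.domain = {x | ∀ i, x i ∈ Set.Ioo (0:ℝ) 1} →
      EqOn B.integrand (fun x => ((c - c / (d + 1) : ℚ) : ℝ) / (1 - x 0 * x 1)) B.domain →
      of Gd - of B ∈ relations) := by
  exact ⟨cyclo_base_inv c d, cyclo_base_geom c d⟩

end Summit.KontsevichZagierPeriods.HurwitzMicroSectors.NormalFormPrinciple.PiBox.M2
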